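import Summits.NavierStokesRegularity.NavierStokesRegularity.Theorems.RobustBlowupPortabilityDivFreeTruncationKernel
import HarnessLib

/-!
# The corrector of the averaged truncation: splitting and substitution
  (tools for item stmt-NavierStokesRegularity-2928, `RobustBlowupPortability.DivFreeTruncation`)

On `ℝ³ = EuclideanSpace ℝ (Fin 3)`. For a continuous kernel `K(x, a, t) ∈ L(ℝ³)` vanishing for
`‖a‖ > ρ/16` and a continuous field `V`, the corrector
`𝒢(y) = ∫_{‖a‖ ≤ ρ/16} ∫₀¹ K(y, a, t)[V(t(y − a) + a)] dt da` splits at `t = 5/8` into two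
product-set integrals (`corrector_split`), and on `‖y‖ < 2ρ` the part `t ≤ 5/8` equals, after the
substitution `b = (1 − t)a + ty` in the inner integral,
`∫_{‖b‖ ≤ 3ρ/2} ∫₀^{5/8} ι(t)³ K(y, ι(t)(b − ty), t)[V(b)] dt db` with any `ι` agreeing with
`(1 − t)⁻¹` on `t ≤ 3/4` (`corrector_near_eq_subst`): all the `y`-dependence has moved into the
kernel. Also the elementary Fubini computation `∫_{S × [t₁,t₂]} w(b) = (t₂ − t₁) ∫_S w`
(`setIntegral_prod_fst`).

HONEST FRAMING: calculus lemmas; nothing here bears on Navier–Stokes regularity.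
-/

noncomputable section

set_option linter.dupNamespace false

namespace Summit.NavierStokesRegularity.NavierStokesRegularity.Theorems

open Set MeasureTheory Filter Topology Function ContinuousLinearMap Module Metric
open scoped ContDiff

namespace DivFreeTruncation

/-- Continuity of the corrector integrand `(a, t) ↦ K(y, a, t)[V(t(y − a) + a)]`. [folklore] -/
theorem continuous_correctorIntegrand
    {K : EuclideanSpace ℝ (Fin 3) → EuclideanSpace ℝ (Fin 3) → ℝ →
      (EuclideanSpace ℝ (Fin 3) →L[ℝ] EuclideanSpace ℝ (Fin 3))}
    (hKc : Continuous fun q : EuclideanSpace ℝ (Fin 3) × (EuclideanSpace ℝ (Fin 3) × ℝ) =>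
      K q.1 q.2.1 q.2.2)
    {V : EuclideanSpace ℝ (Fin 3) → EuclideanSpace ℝ (Fin 3)} (hV : Continuous V)
    (y : EuclideanSpace ℝ (Fin 3)) :
    Continuous fun p : EuclideanSpace ℝ (Fin 3) × ℝ =>
      K y p.1 p.2 (V (p.2 • (y - p.1) + p.1)) := by
  have h1 : Continuous fun p : EuclideanSpace ℝ (Fin 3) × ℝ => K y p.1 p.2 :=
    hKc.comp (Continuous.prodMk_right y)
  exact h1.clm_apply (hV.comp ((continuous_snd.smul (continuous_const.sub continuous_fst)).add
    continuous_fst))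

/-- **Splitting the corrector at `t = t₀`** into two product-set integrals. [folklore] -/
theorem corrector_split
    {K : EuclideanSpace ℝ (Fin 3) → EuclideanSpace ℝ (Fin 3) → ℝ →
      (EuclideanSpace ℝ (Fin 3) →L[ℝ] EuclideanSpace ℝ (Fin 3))}
    (hKc : Continuous fun q : EuclideanSpace ℝ (Fin 3) × (EuclideanSpace ℝ (Fin 3) × ℝ) =>
      K q.1 q.2.1 q.2.2)
    {V : EuclideanSpace ℝ (Fin 3) → EuclideanSpace ℝ (Fin 3)} (hV : Continuous V) (r : ℝ)
    (y : EuclideanSpace ℝ (Fin 3)) {t₀ : ℝ} (h0 : 0 ≤ t₀) (h1 : t₀ ≤ 1) :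
    ∫ a in closedBall (0 : EuclideanSpace ℝ (Fin 3)) r, ∫ t in (0 : ℝ)..1,
        K y a t (V (t • (y - a) + a)) =
      (∫ p in closedBall (0 : EuclideanSpace ℝ (Fin 3)) r ×ˢ Icc 0 t₀,
        K y p.1 p.2 (V (p.2 • (y - p.1) + p.1))) +
      ∫ p in closedBall (0 : EuclideanSpace ℝ (Fin 3)) r ×ˢ Icc t₀ 1,
        K y p.1 p.2 (V (p.2 • (y - p.1) + p.1)) := by
  set F : EuclideanSpace ℝ (Fin 3) × ℝ → EuclideanSpace ℝ (Fin 3) :=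
    fun p => K y p.1 p.2 (V (p.2 • (y - p.1) + p.1)) with hF_def
  have hF : Continuous F := continuous_correctorIntegrand hKc hV y
  have hS : IsCompact (closedBall (0 : EuclideanSpace ℝ (Fin 3)) r) := isCompact_closedBall _ _
  have hFi : ∀ (a : EuclideanSpace ℝ (Fin 3)) (s₁ s₂ : ℝ),
      IntervalIntegrable (fun t => F (a, t)) volume s₁ s₂ := fun a s₁ s₂ =>
    (hF.comp (Continuous.prodMk_right a)).intervalIntegrable s₁ s₂
  have hsplit : ∀ a, ∫ t in (0 : ℝ)..1, F (a, t) =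
      (∫ t in (0 : ℝ)..t₀, F (a, t)) + ∫ t in t₀..1, F (a, t) := fun a =>
    (intervalIntegral.integral_add_adjacent_intervals (hFi a 0 t₀) (hFi a t₀ 1)).symm
  have hc : ∀ s₁ s₂ : ℝ, Continuous fun a : EuclideanSpace ℝ (Fin 3) =>
      ∫ t in s₁..s₂, F (a, t) := fun s₁ s₂ =>
    intervalIntegral.continuous_parametric_intervalIntegral_of_continuous'
      (f := fun a t => F (a, t)) (hF.comp (continuous_fst.prodMk continuous_snd)) s₁ s₂
  have hi : ∀ s₁ s₂ : ℝ, IntegrableOn (fun a : EuclideanSpace ℝ (Fin 3) =>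
      ∫ t in s₁..s₂, F (a, t)) (closedBall 0 r) volume := fun s₁ s₂ =>
    (hc s₁ s₂).continuousOn.integrableOn_compact hS
  change (∫ a in closedBall (0 : EuclideanSpace ℝ (Fin 3)) r, ∫ t in (0 : ℝ)..1, F (a, t)) =
    (∫ p in closedBall (0 : EuclideanSpace ℝ (Fin 3)) r ×ˢ Icc 0 t₀, F p) +
      ∫ p in closedBall (0 : EuclideanSpace ℝ (Fin 3)) r ×ˢ Icc t₀ 1, F p
  rw [setIntegral_congr_fun measurableSet_closedBall (fun a _ => hsplit a),
    integral_add (hi 0 t₀) (hi t₀ 1),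
    setIntegral_intervalIntegral_eq_setIntegral_prod hF hS h0,
    setIntegral_intervalIntegral_eq_setIntegral_prod hF hS h1]

/-- A product-set integral over `S × T` (volume) as an iterated integral with the `t`-integral
outside. [folklore] -/
theorem setIntegral_prod_eq_integral_snd_fst {G : Type*} [NormedAddCommGroup G] [NormedSpace ℝ G]
    {F : EuclideanSpace ℝ (Fin 3) × ℝ → G} (hF : Continuous F)
    {S : Set (EuclideanSpace ℝ (Fin 3))} (hS : IsCompact S) {T : Set ℝ} (hT : IsCompact T) :
    ∫ p in S ×ˢ T, F p = ∫ t in T, ∫ a in S, F (a, t) := by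
  have hFon : IntegrableOn F (S ×ˢ T) ((volume : Measure (EuclideanSpace ℝ (Fin 3))).prod
      (volume : Measure ℝ)) :=
    hF.continuousOn.integrableOn_compact (hS.prod hT)
  have hFint : Integrable F (((volume : Measure (EuclideanSpace ℝ (Fin 3))).restrict S).prod
      ((volume : Measure ℝ).restrict T)) := by
    rw [Measure.prod_restrict]; exact hFon
  have hmeas : (volume : Measure (EuclideanSpace ℝ (Fin 3) × ℝ)).restrict (S ×ˢ T) =
      (((volume : Measure (EuclideanSpace ℝ (Fin 3))).restrict S).prod
        ((volume : Measure ℝ).restrict T)) := by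
    rw [Measure.volume_eq_prod, Measure.prod_restrict]
  rw [hmeas, integral_prod_symm F hFint]

/-- **The substitution `b = (1 − t)a + ty` in the near part of the corrector.** For a continuous
kernel vanishing for `‖a‖ > ρ/16`, continuous `V`, `ι = (1 − t)⁻¹` on `t ≤ 3/4` and `‖y‖ < 2ρ`:
`∫_{‖a‖≤ρ/16} ∫₀^{5/8} K(y,a,t)[V(t(y−a)+a)] = ∫_{‖b‖≤3ρ/2} ∫₀^{5/8} ι(t)³ K(y, ι(t)(b − ty), t)[V(b)]`
(Fubini, Haar scaling `(1 − t)³`, translation invariance; the new variable stays in `‖b‖ ≤ 3ρ/2`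
by `norm_subst_le`). [folklore] -/
theorem corrector_near_eq_subst
    {K : EuclideanSpace ℝ (Fin 3) → EuclideanSpace ℝ (Fin 3) → ℝ →
      (EuclideanSpace ℝ (Fin 3) →L[ℝ] EuclideanSpace ℝ (Fin 3))}
    (hKc : Continuous fun q : EuclideanSpace ℝ (Fin 3) × (EuclideanSpace ℝ (Fin 3) × ℝ) =>
      K q.1 q.2.1 q.2.2)
    {ρ : ℝ} (hK0 : ∀ x a t, ρ / 16 < ‖a‖ → K x a t = 0)
    {V : EuclideanSpace ℝ (Fin 3) → EuclideanSpace ℝ (Fin 3)} (hV : Continuous V)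
    {ι : ℝ → ℝ} (hιc : Continuous ι) (hι : ∀ t : ℝ, t ≤ 3 / 4 → ι t = (1 - t)⁻¹)
    {y : EuclideanSpace ℝ (Fin 3)} (hy : ‖y‖ < 2 * ρ) :
    ∫ p in closedBall (0 : EuclideanSpace ℝ (Fin 3)) (ρ / 16) ×ˢ Icc (0 : ℝ) (5 / 8),
        K y p.1 p.2 (V (p.2 • (y - p.1) + p.1)) =
      ∫ q in closedBall (0 : EuclideanSpace ℝ (Fin 3)) (3 * ρ / 2) ×ˢ Icc (0 : ℝ) (5 / 8),
        ((ι q.2) ^ 3 • K y (ι q.2 • (q.1 - q.2 • y)) q.2) (V q.1) := by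
  set F : EuclideanSpace ℝ (Fin 3) × ℝ → EuclideanSpace ℝ (Fin 3) :=
    fun p => K y p.1 p.2 (V (p.2 • (y - p.1) + p.1)) with hF_def
  set G : EuclideanSpace ℝ (Fin 3) × ℝ → EuclideanSpace ℝ (Fin 3) :=
    fun q => ((ι q.2) ^ 3 • K y (ι q.2 • (q.1 - q.2 • y)) q.2) (V q.1) with hG_def
  have hF : Continuous F := continuous_correctorIntegrand hKc hV y
  have hG : Continuous G := by
    have h1 : Continuous fun q : EuclideanSpace ℝ (Fin 3) × ℝ =>
        K y (ι q.2 • (q.1 - q.2 • y)) q.2 :=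
      hKc.comp (continuous_const.prodMk (((hιc.comp continuous_snd).smul
        (continuous_fst.sub (continuous_snd.smul continuous_const))).prodMk continuous_snd))
    exact (((hιc.comp continuous_snd).pow 3).smul h1).clm_apply (hV.comp continuous_fst)
  have hS : IsCompact (closedBall (0 : EuclideanSpace ℝ (Fin 3)) (ρ / 16)) :=
    isCompact_closedBall _ _
  have hSb : IsCompact (closedBall (0 : EuclideanSpace ℝ (Fin 3)) (3 * ρ / 2)) :=
    isCompact_closedBall _ _
  have hT : IsCompact (Icc (0 : ℝ) (5 / 8)) := isCompact_Icc
  -- the inner substitution, for each `t ∈ [0, 5/8]`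
  have core : ∀ t ∈ Icc (0 : ℝ) (5 / 8),
      ∫ a in closedBall (0 : EuclideanSpace ℝ (Fin 3)) (ρ / 16), F (a, t) =
        ∫ b in closedBall (0 : EuclideanSpace ℝ (Fin 3)) (3 * ρ / 2), G (b, t) := by
    intro t ht
    obtain ⟨ht0, ht1⟩ := ht
    have hlt : t < 1 := by linarith
    have hne : t ≠ 1 := hlt.ne
    have hιt : ι t = (1 - t)⁻¹ := hι t (by linarith)
    have hFS : ∀ a, a ∉ closedBall (0 : EuclideanSpace ℝ (Fin 3)) (ρ / 16) → F (a, t) = 0 := by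
      intro a ha
      rw [mem_closedBall_zero_iff, not_le] at ha
      simp [hF_def, hK0 y a t ha]
    have hGS : ∀ b, b ∉ closedBall (0 : EuclideanSpace ℝ (Fin 3)) (3 * ρ / 2) → G (b, t) = 0 := by
      intro b hb
      rw [mem_closedBall_zero_iff, not_le] at hb
      have hbig : ρ / 16 < ‖ι t • (b - t • y)‖ := by
        by_contra h
        rw [not_lt, hιt] at h
        have := norm_subst_le h hy.le ht0 ht1
        linarith
      simp [hG_def, hK0 y _ t hbig]
    rw [setIntegral_eq_integral_of_forall_compl_eq_zero hFS,
      setIntegral_eq_integral_of_forall_compl_eq_zero hGS,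
      integral_eq_smul_integral_comp_subst (fun a => F (a, t)) hlt y, ← integral_smul]
    congr 1
    funext b
    have hseg := segment_subst_eq hne y b
    simp only [hF_def, hG_def, hseg, _root_.FunLike.coe_smul, Pi.smul_apply, hιt, inv_pow]
  rw [setIntegral_prod_eq_integral_snd_fst hF hS hT, setIntegral_prod_eq_integral_snd_fst hG hSb hT]
  exact setIntegral_congr_fun measurableSet_Icc core

/-- Fubini for an integrand depending on the first variable only:
`∫_{S × [t₁, t₂]} w(b) = (t₂ − t₁) ∫_S w`. [folklore] -/
theorem setIntegral_prod_fst {w : EuclideanSpace ℝ (Fin 3) → ℝ} (hw : Continuous w)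
    {S : Set (EuclideanSpace ℝ (Fin 3))} (hS : IsCompact S) {t₁ t₂ : ℝ} (ht : t₁ ≤ t₂) :
    ∫ q in S ×ˢ Icc t₁ t₂, w q.1 = (t₂ - t₁) * ∫ b in S, w b := by
  have hF : Continuous fun q : EuclideanSpace ℝ (Fin 3) × ℝ => w q.1 := hw.comp continuous_fst
  have hFon : IntegrableOn (fun q : EuclideanSpace ℝ (Fin 3) × ℝ => w q.1) (S ×ˢ Icc t₁ t₂)
      ((volume : Measure (EuclideanSpace ℝ (Fin 3))).prod (volume : Measure ℝ)) :=
    hF.continuousOn.integrableOn_compact (hS.prod isCompact_Icc)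
  rw [Measure.volume_eq_prod, setIntegral_prod _ hFon]
  simp only [setIntegral_const, Real.volume_real_Icc_of_le ht, smul_eq_mul]
  rw [integral_const_mul]

end DivFreeTruncation

end Summit.NavierStokesRegularity.NavierStokesRegularity.Theorems
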